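import Summits.CriticalPhenomena.PercolationContinuityZ3.Theorems.Transplant.SkelPhiStepINegOrient
import Summits.CriticalPhenomena.PercolationContinuityZ3.Theorems.Transplant.SkelFrmScaleSelect
import HarnessLib

/-!
# N2 (frames-only node `SamePDropOfSkeletonFrm₁`, OPEN) — (ζ″) params ledger, TYPED SHAPE (B′) of record ((R-14), p3-g14 2026-08-22T17:05:27Z):
# the Step-I‴ record AS THE PARAMS COLUMN READS IT — `Skelφ.StepI.DataNS V` = Step I″'s `DataN V` EXTENDED by the two scale SELECTORS of the cofinal colour

builds on p205010 (kernel theorem, internal audit signed; external expert review pending) — nothing in this file uses p205010; NOTHING is claimed about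
the open node `SamePDropOfSkeletonFrm₁` (nor about `SamePDropOfSkeletonNeg₁`, closed in the tree).  DEFINITIONS ONLY (dictionary level, no skeleton, no measure).
Lane `prim-bschramm-*`, seat `prim-bschramm-stmt` (gen 19); helper file (`--supports stmt-CriticalPhenomena-4575 --as helper`); ledger HOME/prim-bschramm-stmt/FRM-PARAMS.md §9 (t7)/(R-14).

WHY.  Without a point symmetry, Martineau–Tassion's equilibrium certifies exits through ONE vertical and ONE slanted side per admissible pair `(M, n)` — a COLOUR; a
Kozma–Nitzan re-run consumes several pairs (short, kit, long, bridge, face-kit pairs) that must share one colour; hp-8's pigeonhole (`Skelφ.ScaleSel.exists_colourCofinal`,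
`selM/selN`, SkelFrmScaleSelect) draws every pair through two selectors.  The design of record (R-14) carries the selectors AS FIELDS OF THE RECORD the params column reads,
so that the N1 column ports over `PlanarSkeletonFrm` with NO arity or argument-order change: each of the five pair constructors calls `(D.sM M₁, D.sN M₁ N)` JOINTLY —
zone size selected from its zone floor `M₁`, width selected from its width floor `N` with THE SAME first argument `M₁` (so the width is certified at the selected zone size,
`ScaleSel.col_selN/adm_selN`) — and the closure instantiates `D⁺ := { O‴.D with sM := selM h, sN := selN h, le_sM := le_selM h, le_sN := le_selN h }` ONCE ((R-5)).
* `Skelφ.StepI.DataNS V` (`extends DataN V`; fields `sM sN le_sM le_sN`), the coercion to `DataN`;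
* `DataNS.orient` — the MERGED record `D.orient DT ori` KEEPS the selectors (`toDataN_orient`, `orient_sM/sN` by `rfl`), so the column's 127 `(D.orient DT ori)` sites port verbatim;
* `DataNS.ofSel` — the record built from a `DataN` and hp-8's selectors of a cofinal colour (the closure's one line), with its field lemmas.
[cite: MartineauTassion2017, §3.2 Lemma 3.2 (square-root trick, one side certified), Lemma 3.5] [cite: KozmaNitzan2024, §4 Theorem 6 (pp. 25–31): the order of constants]
-/

namespace Summit.CriticalPhenomena.PercolationContinuityZ3.Theorems.Transplant

namespace Skelφ.StepI

/-- **The Step-I‴ record as the N2 params column reads it** ((R-14), shape (B′)): Step I″'s `DataN` plus the zone-size selector `sM`, the width selector `sN`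
(FIRST argument = the zone FLOOR handed to `sM`, second = the width floor; the value is a width admissible and of the common colour AT zone size `sM M₁` when the
closure instantiates `(sM, sN) := (ScaleSel.selM h, ScaleSel.selN h)`) and their floor facts. [this work] -/
structure DataNS (V : Type) extends DataN V where
  /-- zone-size selector: a zone size `≥ M₁` (in the cofinal colour's rows) -/
  sM : ℕ → ℕ
  /-- width selector: `sN M₁ N ≥ N`, a width at the zone size selected from the SAME floor `M₁` -/
  sN : ℕ → ℕ → ℕ
  /-- the selected zone size clears its floor -/
  le_sM : ∀ M₁, M₁ ≤ sM M₁
  /-- the selected width clears its floor -/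
  le_sN : ∀ M₁ N, N ≤ sN M₁ N

/-- A `DataNS` is read as its underlying `DataN` wherever a Step-I″ record is expected. [folklore] -/
instance DataNS.instCoeDataN (V : Type) : Coe (DataNS V) (DataN V) := ⟨DataNS.toDataN⟩

variable {V : Type}

/-- **The merged record KEEPS the selectors**: `D⁺.orient DT ori` := Step I″'s merged record `D.orient DT ori` (shared fields from `D`, equilibrium data of the
orientation `ori` selects, `DataN.orient`) together with `D⁺`'s selector fields — so every params value `X … (D.orient DT ori) …` of the N1 column re-elaborates
verbatim over `DataNS`. [this work] -/
def DataNS.orient (D : DataNS V) (DT : DataN V) (ori : V → ℕ → ℕ → Bool) : DataNS V :=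
  { D.toDataN.orient DT ori with sM := D.sM, sN := D.sN, le_sM := D.le_sM, le_sN := D.le_sN }

/-- The merged record's underlying `DataN` is Step I″'s merged record. [folklore] -/
@[simp] theorem DataNS.toDataN_orient (D : DataNS V) (DT : DataN V) (ori : V → ℕ → ℕ → Bool) :
    (D.orient DT ori).toDataN = D.toDataN.orient DT ori := rfl

/-- The merged record's zone selector is `D`'s. [folklore] -/
@[simp] theorem DataNS.orient_sM (D : DataNS V) (DT : DataN V) (ori : V → ℕ → ℕ → Bool) : (D.orient DT ori).sM = D.sM := rfl

/-- The merged record's width selector is `D`'s. [folklore] -/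
@[simp] theorem DataNS.orient_sN (D : DataNS V) (DT : DataN V) (ori : V → ℕ → ℕ → Bool) : (D.orient DT ori).sN = D.sN := rfl

/-- The merged record's shared fields are `D`'s: `M₀`. [folklore] -/
@[simp] theorem DataNS.orient_M₀ (D : DataNS V) (DT : DataN V) (ori : V → ℕ → ℕ → Bool) : (D.orient DT ori).M₀ = D.M₀ := rfl

/-- The merged record's shared fields are `D`'s: `n₁`. [folklore] -/
@[simp] theorem DataNS.orient_n₁ (D : DataNS V) (DT : DataN V) (ori : V → ℕ → ℕ → Bool) : (D.orient DT ori).n₁ = D.n₁ := rfl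

/-- The merged record's shared fields are `D`'s: `R`. [folklore] -/
@[simp] theorem DataNS.orient_R (D : DataNS V) (DT : DataN V) (ori : V → ℕ → ℕ → Bool) : (D.orient DT ori).R = D.R := rfl

/-- The merged record's shared fields are `D`'s: `k`. [folklore] -/
@[simp] theorem DataNS.orient_k (D : DataNS V) (DT : DataN V) (ori : V → ℕ → ℕ → Bool) : (D.orient DT ori).k = D.k := rfl

/-- The merged record's shared fields are `D`'s: `Λ`. [folklore] -/
@[simp] theorem DataNS.orient_Λ (D : DataNS V) (DT : DataN V) (ori : V → ℕ → ℕ → Bool) : (D.orient DT ori).Λ = D.Λ := rfl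

/-- **The closure's record** `DataNS.ofSel D h := { D with sM := selM h, sN := selN h, … }` for a Step-I″ record `D` and a cofinal colour `h` of an admissibility/colour
pair `(adm, col)` (hp-8's `ScaleSel`; (R-5): chosen once). [this work] -/
noncomputable def DataNS.ofSel {C : Type*} {adm : ℕ → ℕ → Prop} {col : ℕ → ℕ → C} {c : C} (D : DataN V) (h : ScaleSel.ColourCofinal adm col c) : DataNS V :=
  { D with sM := ScaleSel.selM h, sN := ScaleSel.selN h, le_sM := ScaleSel.le_selM h, le_sN := ScaleSel.le_selN h }

/-- `(ofSel D h).toDataN = D`. [folklore] -/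
@[simp] theorem DataNS.toDataN_ofSel {C : Type*} {adm : ℕ → ℕ → Prop} {col : ℕ → ℕ → C} {c : C} (D : DataN V) (h : ScaleSel.ColourCofinal adm col c) :
    (DataNS.ofSel D h).toDataN = D := rfl

/-- `(ofSel D h).sM = selM h`. [folklore] -/
@[simp] theorem DataNS.ofSel_sM {C : Type*} {adm : ℕ → ℕ → Prop} {col : ℕ → ℕ → C} {c : C} (D : DataN V) (h : ScaleSel.ColourCofinal adm col c) :
    (DataNS.ofSel D h).sM = ScaleSel.selM h := rfl

/-- `(ofSel D h).sN = selN h`. [folklore] -/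
@[simp] theorem DataNS.ofSel_sN {C : Type*} {adm : ℕ → ℕ → Prop} {col : ℕ → ℕ → C} {c : C} (D : DataN V) (h : ScaleSel.ColourCofinal adm col c) :
    (DataNS.ofSel D h).sN = ScaleSel.selN h := rfl

/-- **Every pair the column selects is admissible and of the common colour**: at any zone floor `M₁` and width floor `N`,
`adm (sM M₁) (sN M₁ N)` and `col (sM M₁) (sN M₁ N) = c` for the closure's record (read off `ScaleSel.adm_selN/col_selN`). [folklore] -/
theorem DataNS.ofSel_adm_col {C : Type*} {adm : ℕ → ℕ → Prop} {col : ℕ → ℕ → C} {c : C} (D : DataN V) (h : ScaleSel.ColourCofinal adm col c) (M₁ N : ℕ) :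
    adm ((DataNS.ofSel D h).sM M₁) ((DataNS.ofSel D h).sN M₁ N) ∧ col ((DataNS.ofSel D h).sM M₁) ((DataNS.ofSel D h).sN M₁ N) = c :=
  ⟨ScaleSel.adm_selN h M₁ N, ScaleSel.col_selN h M₁ N⟩

end Skelφ.StepI

end Summit.CriticalPhenomena.PercolationContinuityZ3.Theorems.Transplant
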